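import Literature.MathematicalPhysics.QuantumFieldTheory.WilsonPlaquetteWeakCouplingFloor
import Literature.MathematicalPhysics.QuantumLattice.SU2HaarSmallBall
import HarnessLib

/-!
# The weak-coupling plaquette floor and string-tension ceiling for `SU(2)`, with explicit constants

The group-agnostic weak-coupling floor of `WilsonPlaquetteWeakCouplingFloor`
(`wilsonExpectation_plaquette_ge_linkBall`: `⟨(1/N) Re tr ρ(U_p)⟩_{Λ_L,β} ≥ 1 - 8r²/N + 2 log
φ_ρ(r)/((d-1)Nβ)` uniformly in `L`, `φ_ρ(r) = Haar{‖ρ(g) - 1‖_F ≤ r}`) made EXPLICIT for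
`G = SU(2)` in the fundamental representation by the tree's polynomial small-ball bound for the
Haar measure of `SU(2)` (`le_haarProbability_su2_two_sub_trace_le`:
`Haar{2 - Re tr U ≤ η} ≥ η²/16`, `0 < η ≤ 1/4`, the estimate in the proof of Chatterjee's
Lemma 5.5):

* `haarProbability_real_ball_ge_su2` — `φ(r) ≥ r⁴/64` for `0 < r`, `r² ≤ 1/2`
  (`‖U - 1‖_F² = 2(2 - Re tr U)` on `SU(2)`);
* `su2_floor_le` — with `K := (d-1)β ≥ 2` and the radius `r = K^{-1/2}`, the floor of the generic
  theorem is at least `1 - (9 + 2 log K)/K` (`log 64 ≤ 5`);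
* `wilsonExpectation_plaquette_ge_su2` — **for every `d ≥ 2`, torus size `L`, site `x`, axes
  `i ≠ j` and every `β` with `K = (d-1)β ≥ 2`: `⟨½ Re tr U_{x,ij}⟩_{Λ_L,β} ≥ 1 - (9 + 2 log K)/K`**,
  i.e. the internal energy `E = ⟨1 - ½ tr U_p⟩` of `SU(2)` lattice gauge theory is at most
  `(9 + 2 log((d-1)β))/((d-1)β)` UNIFORMLY IN THE VOLUME — an explicit `O(log β/β)` law (the
  logarithm is intrinsic to the Jensen bound `⟨S⟩_β ≤ -log Z(β)/β` behind the generic theorem,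
  since `-log Z(β) = ∫₀^β ⟨S⟩_b db`; a sharper small-ball bound only improves the constants);
* `rectExpectation_one_one_ge_su2` — the same floor for `W_μ(1×1)` of every infinite-volume limit
  state `μ ∈ infiniteVolumeLimitPoints (fundamentalRep (Fin 2)) β`;
* `stringTension_le_su2` — if moreover `9 + 2 log K < K`, every such limit state has a string
  tension with `0 ≤ σ(μ) ≤ -log(1 - (9 + 2 log K)/K)`: the lattice string tension of `SU(2)`
  lattice gauge theory (every `d ≥ 2`) is `O(log β/β)` at weak coupling, for every limit state,
  with explicit constants; `stringTension_le_su2_of_le` — for `K ≥ 18` the smallness hypothesis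
  is automatic (in `d = 4`: tree `β ≥ 6`, Wilson `β_W ≥ 12`);
* `wilsonExpectation_plaquette_ge_su2_dim_four`, `stringTension_le_su2_dim_four`,
  `stringTension_le_su2_dim_three` — the `d = 4` (`K = 3β`) and `d = 3` (`K = 2β`) readings.

Units: the tree's `β` multiplies `Σ_p (2 - Re tr U_p)`, so `β = β_W/2` for Wilson's
`β_W Σ_p (1 - ½ tr U_p)`; in `d = 4`, `K = 3β = 3β_W/2`. Honest placement: elementary consequences
(not printed in this form) of the convexity mechanism [Friedli–Velenik 2017, Lemma 3.5, App. B.8.1]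
and of the small-ball estimate in the proof of [Chatterjee, arXiv:2401.10507, Lemma 5.5]; the
internal energy is Montvay–Münster's (3.113). Nothing continuum; `σ` in lattice units.
-/

noncomputable section

open MeasureTheory Filter Topology
open scoped Matrix Matrix.Norms.Frobenius
open Literature.MathematicalPhysics.QuantumLattice Literature.Probability.LatticeModels

namespace Literature.MathematicalPhysics.QuantumFieldTheory

/-- `log 64 ≤ 5` (`64 < e⁵` since `e > 2.718`). [folklore] -/
private theorem log_64_le_five : Real.log 64 ≤ 5 := by
  have h1 : Real.exp 5 = Real.exp 1 ^ 5 := by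
    rw [← Real.exp_nat_mul]; norm_num
  have h2 : (2.718 : ℝ) ^ 5 < Real.exp 1 ^ 5 := by
    have he : (2.718 : ℝ) < Real.exp 1 := lt_trans (by norm_num) Real.exp_one_gt_d9
    gcongr
  have h5 : (64 : ℝ) ≤ Real.exp 5 := by
    rw [h1]
    exact (lt_trans (by norm_num) h2).le
  rw [Real.log_le_iff_le_exp (by norm_num)]
  exact h5

/-- **Explicit small-ball bound for `SU(2)`**: `Haar{U ∈ SU(2) : ‖U - 1‖_F ≤ r} ≥ r⁴/64` for
`0 < r`, `r² ≤ 1/2` — from the tree's `Haar{2 - Re tr U ≤ η} ≥ η²/16` (`η = r²/2 ≤ 1/4`) and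
`‖U - 1‖_F² = 2(2 - Re tr U)`.
[cite: Chatterjee2026YMHiggs, proof of Lemma 5.5 (Haar measure of Σ')] -/
theorem haarProbability_real_ball_ge_su2 {r : ℝ} (hr : 0 < r) (hr2 : r ^ 2 ≤ 1 / 2) :
    r ^ 4 / 64 ≤ (haarProbability (Matrix.specialUnitaryGroup (Fin 2) ℂ)).real
      {U : Matrix.specialUnitaryGroup (Fin 2) ℂ | ‖fundamentalRep (Fin 2) U - 1‖ ≤ r} := by
  have hη0 : 0 < r ^ 2 / 2 := by positivity
  have hη : r ^ 2 / 2 ≤ 1 / 4 := by linarith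
  have hsub : {U : Matrix.specialUnitaryGroup (Fin 2) ℂ |
        2 - ((U : Matrix (Fin 2) (Fin 2) ℂ).trace).re ≤ r ^ 2 / 2} ⊆
      {U : Matrix.specialUnitaryGroup (Fin 2) ℂ | ‖fundamentalRep (Fin 2) U - 1‖ ≤ r} := by
    intro U hU
    have hU' : (2 : ℝ) - ((U : Matrix (Fin 2) (Fin 2) ℂ).trace).re ≤ r ^ 2 / 2 := hU
    have hid := sub_re_trace_eq_half_norm_sub_one_sq (fundamentalRep_mem_unitaryGroup U)
    rw [fundamentalRep_apply] at hid
    have hsq : ‖(U : Matrix (Fin 2) (Fin 2) ℂ) - 1‖ ^ 2 ≤ r ^ 2 := by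
      have : ((2 : ℕ) : ℝ) = 2 := by norm_num
      rw [this] at hid
      linarith
    show ‖fundamentalRep (Fin 2) U - 1‖ ≤ r
    rw [fundamentalRep_apply]
    exact (pow_le_pow_iff_left₀ (norm_nonneg _) hr.le two_ne_zero).1 hsq
  have h := le_haarProbability_su2_two_sub_trace_le hη0 hη
  have h64 : r ^ 4 / 64 = (r ^ 2 / 2) ^ 2 / 16 := by ring
  rw [h64, measureReal_def, ← ENNReal.ofReal_le_iff_le_toReal (measure_ne_top _ _)]
  exact h.trans (measure_mono hsub)

/-- **The explicit floor.** For `d ≥ 2` and `K := (d-1)β ≥ 2`, with the radius `r = K^{-1/2}`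
(`r² = 1/K ≤ 1/2`), the floor of `wilsonExpectation_plaquette_ge_linkBall` for `SU(2)` is at least
`1 - (9 + 2 log K)/K`: `8r²/2 = 4/K`, `log φ(r) ≥ log(r⁴/64) = -2 log K - log 64 ≥ -2 log K - 5`.
[cite: Chatterjee2026YMHiggs, proof of Lemma 5.5 (Haar measure of Σ')] -/
theorem su2_floor_le {d : ℕ} (hd : 2 ≤ d) {β : ℝ} (hK : 2 ≤ ((d : ℝ) - 1) * β) :
    1 - (9 + 2 * Real.log (((d : ℝ) - 1) * β)) / (((d : ℝ) - 1) * β) ≤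
      1 - 8 * Real.sqrt (1 / (((d : ℝ) - 1) * β)) ^ 2 / (2 : ℕ) +
        2 * Real.log ((haarProbability (Matrix.specialUnitaryGroup (Fin 2) ℂ)).real
            {U : Matrix.specialUnitaryGroup (Fin 2) ℂ |
              ‖fundamentalRep (Fin 2) U - 1‖ ≤ Real.sqrt (1 / (((d : ℝ) - 1) * β))}) /
          (((d : ℝ) - 1) * (2 : ℕ) * β) := by
  have hd1 : (0 : ℝ) < (d : ℝ) - 1 := by
    have : (2 : ℝ) ≤ d := by exact_mod_cast hd
    linarith
  set K : ℝ := ((d : ℝ) - 1) * β with hKdef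
  have hK0 : 0 < K := by linarith
  have hβ0 : β ≠ 0 := by
    rintro rfl
    simp [hKdef] at hK0
  set r : ℝ := Real.sqrt (1 / K) with hr
  have hr0 : 0 < r := Real.sqrt_pos.2 (by positivity)
  have hr2 : r ^ 2 = 1 / K := by rw [hr, Real.sq_sqrt (by positivity)]
  have hr2le : r ^ 2 ≤ 1 / 2 := by
    rw [hr2]
    exact one_div_le_one_div_of_le (by norm_num) hK
  set φ : ℝ := (haarProbability (Matrix.specialUnitaryGroup (Fin 2) ℂ)).real
    {U : Matrix.specialUnitaryGroup (Fin 2) ℂ | ‖fundamentalRep (Fin 2) U - 1‖ ≤ r} with hφ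
  have hφge : r ^ 4 / 64 ≤ φ := haarProbability_real_ball_ge_su2 hr0 hr2le
  have hr4 : 0 < r ^ 4 / 64 := by positivity
  have hlog : -2 * Real.log K - Real.log 64 ≤ Real.log φ := by
    have h1 : Real.log (r ^ 4 / 64) ≤ Real.log φ := Real.log_le_log hr4 hφge
    have h2 : Real.log (r ^ 4 / 64) = 2 * Real.log (r ^ 2) - Real.log 64 := by
      rw [Real.log_div (by positivity) (by norm_num), show r ^ 4 = (r ^ 2) ^ 2 by ring,
        Real.log_pow]
      ring
    have h3 : Real.log (r ^ 2) = -Real.log K := by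
      rw [hr2, one_div, Real.log_inv]
    linarith
  have key : (4 - Real.log φ) / K ≤ (9 + 2 * Real.log K) / K :=
    div_le_div_of_nonneg_right (by linarith [log_64_le_five]) hK0.le
  have e1 : (4 - Real.log φ) / K = 4 / K - Real.log φ / K := sub_div _ _ _
  have e2 : 8 * r ^ 2 / ((2 : ℕ) : ℝ) = 4 / K := by
    rw [hr2]; push_cast; field_simp; ring
  have e3 : 2 * Real.log φ / (((d : ℝ) - 1) * ((2 : ℕ) : ℝ) * β) = Real.log φ / K := by
    rw [hKdef]; push_cast; field_simp
  rw [e2, e3]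
  linarith

/-- **The `SU(2)` plaquette at weak coupling, explicit and uniform in the volume.** For every
`d ≥ 2`, torus size `L`, site `x`, axes `i ≠ j` and every `β` with `K = (d-1)β ≥ 2`,
`⟨½ Re tr U_{x,ij}⟩_{Λ_L,β} ≥ 1 - (9 + 2 log K)/K`; equivalently the internal energy
`E = ⟨1 - ½ tr U_p⟩ ≤ (9 + 2 log((d-1)β))/((d-1)β)` (Montvay–Münster (3.113); elementary, not
printed in this form). [cite: MontvayMunster1994, §3.2 (3.113), PDF p. 123]
[cite: FriedliVelenik2017, Lemma 3.5 (p. 94), App. B.8.1] -/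
theorem wilsonExpectation_plaquette_ge_su2 {d L : ℕ} [NeZero L] (hd : 2 ≤ d) {β : ℝ}
    (hK : 2 ≤ ((d : ℝ) - 1) * β) (x : Site d L) {i j : Fin d} (hij : i ≠ j) :
    1 - (9 + 2 * Real.log (((d : ℝ) - 1) * β)) / (((d : ℝ) - 1) * β) ≤
      wilsonExpectation (fundamentalRep (Fin 2)) β
        (fun U : GaugeConfig d L (Matrix.specialUnitaryGroup (Fin 2) ℂ) =>
          ((2 : ℕ) : ℝ)⁻¹ * (fundamentalRep (Fin 2) (plaquetteHolonomy U x i j)).trace.re) := by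
  have hd1 : (0 : ℝ) < (d : ℝ) - 1 := by
    have : (2 : ℝ) ≤ d := by exact_mod_cast hd
    linarith
  have hβ : 0 < β := by
    by_contra h
    have : ((d : ℝ) - 1) * β ≤ 0 := mul_nonpos_of_nonneg_of_nonpos hd1.le (not_lt.1 h)
    linarith
  have hr0 : 0 < Real.sqrt (1 / (((d : ℝ) - 1) * β)) := Real.sqrt_pos.2 (by positivity)
  exact (su2_floor_le hd hK).trans
    (wilsonExpectation_plaquette_ge_linkBall (fundamentalRep (Fin 2)) hd (by norm_num)
      (continuous_fundamentalRep (Fin 2)) fundamentalRep_mem_unitaryGroup hβ hr0 x hij)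

/-- **The same explicit floor for every infinite-volume limit state**: for `d ≥ 2`,
`K = (d-1)β ≥ 2` and `μ ∈ infiniteVolumeLimitPoints (fundamentalRep (Fin 2)) β`,
`W_μ(1 × 1) ≥ 1 - (9 + 2 log K)/K`. [cite: SeilerLNP1982, Ch. 2]
[cite: FriedliVelenik2017, Lemma 3.5 (p. 94), App. B.8.1] -/
theorem rectExpectation_one_one_ge_su2 {d : ℕ} [NeZero d] (hd : 2 ≤ d) {β : ℝ}
    (hK : 2 ≤ ((d : ℝ) - 1) * β) {μ : Measure (LGConfig d (Matrix.specialUnitaryGroup (Fin 2) ℂ))}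
    (hμ : μ ∈ infiniteVolumeLimitPoints (fundamentalRep (Fin 2)) β) :
    1 - (9 + 2 * Real.log (((d : ℝ) - 1) * β)) / (((d : ℝ) - 1) * β) ≤
      rectExpectation μ (fun g => normalisedCharacter 2 (fundamentalRep (Fin 2) g)) 0 1 1 1 := by
  have hd1 : (0 : ℝ) < (d : ℝ) - 1 := by
    have : (2 : ℝ) ≤ d := by exact_mod_cast hd
    linarith
  have hβ : 0 < β := by
    by_contra h
    have : ((d : ℝ) - 1) * β ≤ 0 := mul_nonpos_of_nonneg_of_nonpos hd1.le (not_lt.1 h)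
    linarith
  have hr0 : 0 < Real.sqrt (1 / (((d : ℝ) - 1) * β)) := Real.sqrt_pos.2 (by positivity)
  exact (su2_floor_le hd hK).trans
    (rectExpectation_one_one_ge_linkBall (fundamentalRep (Fin 2)) hd (by norm_num)
      (continuous_fundamentalRep (Fin 2)) fundamentalRep_mem_unitaryGroup hβ hr0 hμ)

/-- **Explicit weak-coupling ceiling on the `SU(2)` lattice string tension.** For `d ≥ 2`,
`K = (d-1)β ≥ 2` with `9 + 2 log K < K`, every infinite-volume limit state
`μ ∈ infiniteVolumeLimitPoints (fundamentalRep (Fin 2)) β` HAS a string tension and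
`0 ≤ σ(μ) ≤ -log(1 - (9 + 2 log K)/K)` — an `O(log β/β)` bound in lattice units (in `d = 4`,
`K = 3β = 3β_W/2`). [cite: SeilerLNP1982, Ch. 2]
[cite: FriedliVelenik2017, Lemma 3.5 (p. 94), App. B.8.1] -/
theorem stringTension_le_su2 {d : ℕ} [NeZero d] (hd : 2 ≤ d) {β : ℝ}
    (hK : 2 ≤ ((d : ℝ) - 1) * β)
    (hsmall : 9 + 2 * Real.log (((d : ℝ) - 1) * β) < ((d : ℝ) - 1) * β)
    {μ : Measure (LGConfig d (Matrix.specialUnitaryGroup (Fin 2) ℂ))}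
    (hμ : μ ∈ infiniteVolumeLimitPoints (fundamentalRep (Fin 2)) β) :
    HasStringTension μ (fun g => normalisedCharacter 2 (fundamentalRep (Fin 2) g))
        (stringTension μ (fun g => normalisedCharacter 2 (fundamentalRep (Fin 2) g))) ∧
      0 ≤ stringTension μ (fun g => normalisedCharacter 2 (fundamentalRep (Fin 2) g)) ∧
      stringTension μ (fun g => normalisedCharacter 2 (fundamentalRep (Fin 2) g)) ≤
        -Real.log (1 - (9 + 2 * Real.log (((d : ℝ) - 1) * β)) / (((d : ℝ) - 1) * β)) := by
  have hd1 : (0 : ℝ) < (d : ℝ) - 1 := by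
    have : (2 : ℝ) ≤ d := by exact_mod_cast hd
    linarith
  have hK0 : 0 < ((d : ℝ) - 1) * β := by linarith
  have hβ : 0 < β := by
    by_contra h
    have : ((d : ℝ) - 1) * β ≤ 0 := mul_nonpos_of_nonneg_of_nonpos hd1.le (not_lt.1 h)
    linarith
  have hr0 : 0 < Real.sqrt (1 / (((d : ℝ) - 1) * β)) := Real.sqrt_pos.2 (by positivity)
  have hpos : 0 < 1 - (9 + 2 * Real.log (((d : ℝ) - 1) * β)) / (((d : ℝ) - 1) * β) := by
    rw [sub_pos, div_lt_one hK0]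
    exact hsmall
  have hfl := su2_floor_le hd hK
  have hfloor := hpos.trans_le hfl
  obtain ⟨hσ, hσ0, hσle⟩ := stringTension_le_linkBall (fundamentalRep (Fin 2)) hd (by norm_num)
    (continuous_fundamentalRep (Fin 2)) fundamentalRep_mem_unitaryGroup hβ hr0 hfloor hμ
  exact ⟨hσ, hσ0, hσle.trans (neg_le_neg (Real.log_le_log hpos hfl))⟩

/-- `log 18 < 3` (`18 < e³` since `e > 2.718`). [folklore] -/
private theorem log_18_lt_three : Real.log 18 < 3 := by
  have h1 : Real.exp 3 = Real.exp 1 ^ 3 := by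
    rw [← Real.exp_nat_mul]; norm_num
  have h2 : (2.718 : ℝ) ^ 3 < Real.exp 1 ^ 3 := by
    have he : (2.718 : ℝ) < Real.exp 1 := lt_trans (by norm_num) Real.exp_one_gt_d9
    gcongr
  rw [Real.log_lt_iff_lt_exp (by norm_num), h1]
  exact lt_trans (by norm_num) h2

/-- For `K ≥ 18`, `9 + 2 log K < K` (`log K = log 18 + log(K/18) ≤ log 18 + K/18 - 1` and
`log 18 < 3`). [folklore] -/
private theorem nine_add_two_mul_log_lt {K : ℝ} (hK : 18 ≤ K) : 9 + 2 * Real.log K < K := by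
  have h1 : Real.log K = Real.log 18 + Real.log (K / 18) := by
    rw [← Real.log_mul (by norm_num) (by positivity)]
    congr 1
    ring
  have h2 : Real.log (K / 18) ≤ K / 18 - 1 := Real.log_le_sub_one_of_pos (by positivity)
  linarith [log_18_lt_three]

/-- **Beyond a numeric threshold the smallness hypothesis is automatic.** For `d ≥ 2` and
`(d-1)β ≥ 18` (in `d = 4`: tree `β ≥ 6`, i.e. Wilson `β_W ≥ 12`) every infinite-volume limit
state `μ ∈ infiniteVolumeLimitPoints (fundamentalRep (Fin 2)) β` of `SU(2)` lattice gauge theory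
has a string tension with `0 ≤ σ(μ) ≤ -log(1 - (9 + 2 log((d-1)β))/((d-1)β))` (lattice units).
[cite: SeilerLNP1982, Ch. 2] [cite: FriedliVelenik2017, Lemma 3.5 (p. 94), App. B.8.1] -/
theorem stringTension_le_su2_of_le {d : ℕ} [NeZero d] (hd : 2 ≤ d) {β : ℝ}
    (hK : 18 ≤ ((d : ℝ) - 1) * β)
    {μ : Measure (LGConfig d (Matrix.specialUnitaryGroup (Fin 2) ℂ))}
    (hμ : μ ∈ infiniteVolumeLimitPoints (fundamentalRep (Fin 2)) β) :
    HasStringTension μ (fun g => normalisedCharacter 2 (fundamentalRep (Fin 2) g))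
        (stringTension μ (fun g => normalisedCharacter 2 (fundamentalRep (Fin 2) g))) ∧
      0 ≤ stringTension μ (fun g => normalisedCharacter 2 (fundamentalRep (Fin 2) g)) ∧
      stringTension μ (fun g => normalisedCharacter 2 (fundamentalRep (Fin 2) g)) ≤
        -Real.log (1 - (9 + 2 * Real.log (((d : ℝ) - 1) * β)) / (((d : ℝ) - 1) * β)) :=
  stringTension_le_su2 hd (by linarith) (nine_add_two_mul_log_lt hK) hμ

/-- **`d = 4` reading of the plaquette floor** (`K = 3β`; tree `β ≥ 2/3`): for every torus size
`L`, site `x` and axes `i ≠ j`, `⟨½ Re tr U_{x,ij}⟩_{Λ_L,β} ≥ 1 - (9 + 2 log(3β))/(3β)`.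
[cite: MontvayMunster1994, §3.2 (3.113), PDF p. 123]
[cite: FriedliVelenik2017, Lemma 3.5 (p. 94), App. B.8.1] -/
theorem wilsonExpectation_plaquette_ge_su2_dim_four {L : ℕ} [NeZero L] {β : ℝ} (hβ : 2 / 3 ≤ β)
    (x : Site 4 L) {i j : Fin 4} (hij : i ≠ j) :
    1 - (9 + 2 * Real.log (3 * β)) / (3 * β) ≤
      wilsonExpectation (fundamentalRep (Fin 2)) β
        (fun U : GaugeConfig 4 L (Matrix.specialUnitaryGroup (Fin 2) ℂ) =>
          ((2 : ℕ) : ℝ)⁻¹ * (fundamentalRep (Fin 2) (plaquetteHolonomy U x i j)).trace.re) := by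
  have h3 : ((4 : ℕ) : ℝ) - 1 = 3 := by norm_num
  have h := wilsonExpectation_plaquette_ge_su2 (d := 4) (by norm_num) (β := β)
    (by rw [h3]; linarith) x hij
  rw [h3] at h
  exact h

/-- **`d = 4` reading of the string-tension ceiling** (`K = 3β`; tree `β ≥ 6`, i.e. Wilson
`β_W ≥ 12`): every infinite-volume limit state of four-dimensional `SU(2)` lattice gauge theory has
a string tension with `0 ≤ σ(μ) ≤ -log(1 - (9 + 2 log(3β))/(3β))` (lattice units).
[cite: SeilerLNP1982, Ch. 2] [cite: FriedliVelenik2017, Lemma 3.5 (p. 94), App. B.8.1] -/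
theorem stringTension_le_su2_dim_four {β : ℝ} (hβ : 6 ≤ β)
    {μ : Measure (LGConfig 4 (Matrix.specialUnitaryGroup (Fin 2) ℂ))}
    (hμ : μ ∈ infiniteVolumeLimitPoints (fundamentalRep (Fin 2)) β) :
    HasStringTension μ (fun g => normalisedCharacter 2 (fundamentalRep (Fin 2) g))
        (stringTension μ (fun g => normalisedCharacter 2 (fundamentalRep (Fin 2) g))) ∧
      0 ≤ stringTension μ (fun g => normalisedCharacter 2 (fundamentalRep (Fin 2) g)) ∧
      stringTension μ (fun g => normalisedCharacter 2 (fundamentalRep (Fin 2) g)) ≤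
        -Real.log (1 - (9 + 2 * Real.log (3 * β)) / (3 * β)) := by
  have h3 : ((4 : ℕ) : ℝ) - 1 = 3 := by norm_num
  have h := stringTension_le_su2_of_le (d := 4) (by norm_num) (β := β) (by rw [h3]; linarith) hμ
  rw [h3] at h
  exact h

/-- **`d = 3` reading of the string-tension ceiling** (`K = 2β`; tree `β ≥ 9`): every
infinite-volume limit state of three-dimensional `SU(2)` lattice gauge theory has a string tension
with `0 ≤ σ(μ) ≤ -log(1 - (9 + 2 log(2β))/(2β))` (lattice units).
[cite: SeilerLNP1982, Ch. 2] [cite: FriedliVelenik2017, Lemma 3.5 (p. 94), App. B.8.1] -/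
theorem stringTension_le_su2_dim_three {β : ℝ} (hβ : 9 ≤ β)
    {μ : Measure (LGConfig 3 (Matrix.specialUnitaryGroup (Fin 2) ℂ))}
    (hμ : μ ∈ infiniteVolumeLimitPoints (fundamentalRep (Fin 2)) β) :
    HasStringTension μ (fun g => normalisedCharacter 2 (fundamentalRep (Fin 2) g))
        (stringTension μ (fun g => normalisedCharacter 2 (fundamentalRep (Fin 2) g))) ∧
      0 ≤ stringTension μ (fun g => normalisedCharacter 2 (fundamentalRep (Fin 2) g)) ∧
      stringTension μ (fun g => normalisedCharacter 2 (fundamentalRep (Fin 2) g)) ≤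
        -Real.log (1 - (9 + 2 * Real.log (2 * β)) / (2 * β)) := by
  have h2 : ((3 : ℕ) : ℝ) - 1 = 2 := by norm_num
  have h := stringTension_le_su2_of_le (d := 3) (by norm_num) (β := β) (by rw [h2]; linarith) hμ
  rw [h2] at h
  exact h

end Literature.MathematicalPhysics.QuantumFieldTheory

end
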